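import Mathlib.LinearAlgebra.Matrix.Block
import Mathlib.Analysis.RCLike.Basic
import HarnessLib

/-!
# Determinants with unit rows: reduction to the complementary minor

A bookkeeping lemma of the Brydges–Battle–Federbush tree expansion of truncated fermionic
expectations (Benfatto–Giuliani–Mastropietro 2006, (2.66); Mastropietro 2008, (2.110)–(2.118)): after
the tree lines have been extracted, the remaining interpolated propagator matrix has, in the rows of the
fields already used by tree lines, UNIT rows `e_{j(a)}` (`FermionicTreeExpansion.tmpl`), and its
determinant is — up to sign, and unless two unit rows coincide — the complementary minor (delete the
unit rows `a ∈ I` and their columns `j(a)`). The tree's Gram–Hadamard version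
(`Literature.Analysis.InnerProduct.GramHadamardUnitRows.norm_det_le_of_unit_rows`) bounds such a
determinant when the other rows are in GRAM form; for propagators that only carry an abstract
determinant bound on their minors (the chronological propagators of positive-temperature fermions,
de Siqueira Pedra–Salmhofer 2008, which have no good Gram representation) one needs the reduction
itself:

* `Matrix.norm_det_le_of_unit_rows_of_minor_bound` — if the rows `a ∈ I` of `N` are the unit rows
  `e_{j a}` and every minor of `N` on `r - |I|` strictly increasing rows avoiding `I` and strictly
  increasing columns avoiding `j(I)` has `‖det‖ ≤ D` (`0 ≤ D`), then `‖det N‖ ≤ D`.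

Proof: if `j` is not injective on `I` two rows coincide; otherwise permute the columns so that the unit
rows become diagonal (`Matrix.det_permute'`), and apply the block-triangular determinant formula
`Matrix.twoBlockTriangular_det'` — the `I`-block is the identity and the complementary block is the
said minor. Everything is PROVED; no definition. [folklore]

## Mathlib search
`Matrix.twoBlockTriangular_det'`, `Matrix.toSquareBlockProp_def`, `Matrix.det_permute'`,
`Matrix.det_one`, `Matrix.det_zero_of_row_eq`, `Matrix.det_submatrix_equiv_self`,
`Finset.orderIsoOfFin`, `Finset.card_univ_sdiff`, `Finite.surjective_of_injective`,
`Int.units_eq_one_or`.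
-/

noncomputable section

open Finset

namespace Matrix

variable {𝕜 : Type*} [RCLike 𝕜]

/-- The cast of the sign of a permutation has norm one. [folklore] -/
theorem norm_coe_sign_eq_one {n : Type*} [Fintype n] [DecidableEq n] (σ : Equiv.Perm n) :
    ‖((Equiv.Perm.sign σ : ℤ) : 𝕜)‖ = 1 := by
  rcases Int.units_eq_one_or (Equiv.Perm.sign σ) with h | h <;> simp [h]

/-- **Determinants with unit rows reduce to the complementary minor.** Let `N` be an `r × r` matrix
whose row `a` is the unit row `e_{j a}` for every `a ∈ I`. If every minor of `N` with `r - |I|`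
strictly increasing rows outside `I` and strictly increasing columns outside `j(I)` has norm at most
`D ≥ 0`, then `‖det N‖ ≤ D`. (If `j` is injective on `I` there is exactly one such minor and
`|det N|` equals its norm; otherwise two rows of `N` coincide and `det N = 0`.) [folklore] -/
theorem norm_det_le_of_unit_rows_of_minor_bound {r : ℕ} (N : Matrix (Fin r) (Fin r) 𝕜)
    (I : Finset (Fin r)) (j : Fin r → Fin r)
    (hrow : ∀ a ∈ I, ∀ b, N a b = if b = j a then 1 else 0) {D : ℝ} (hD : 0 ≤ D)
    (hminor : ∀ ρ γ : Fin (r - I.card) → Fin r, StrictMono ρ → StrictMono γ →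
      (∀ i, ρ i ∉ I) → (∀ i, γ i ∉ I.image j) → ‖(N.submatrix ρ γ).det‖ ≤ D) :
    ‖N.det‖ ≤ D := by
  classical
  by_cases hinj : Set.InjOn j (I : Set (Fin r))
  swap
  · -- two unit rows coincide
    simp only [Set.InjOn, not_forall] at hinj
    obtain ⟨a, ha, a', ha', hj, hne⟩ := hinj
    have hdet : N.det = 0 := by
      refine Matrix.det_zero_of_row_eq hne ?_
      funext b
      rw [hrow a ha, hrow a' ha', hj]
    rw [hdet, norm_zero]
    exact hD
  -- the complements of `I` and of `J = j(I)`, enumerated increasingly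
  set J : Finset (Fin r) := I.image j with hJ
  have hJcard : J.card = I.card := Finset.card_image_of_injOn hinj
  have hIc : (univ \ I).card = r - I.card := by
    rw [Finset.card_univ_sdiff, Fintype.card_fin]
  have hJc : (univ \ J).card = r - I.card := by
    rw [Finset.card_univ_sdiff, Fintype.card_fin, hJcard]
  set eI := (univ \ I).orderIsoOfFin hIc with heI
  set eJ := (univ \ J).orderIsoOfFin hJc with heJ
  set ρ : Fin (r - I.card) → Fin r := fun i => (eI i : Fin r) with hρ
  set γ : Fin (r - I.card) → Fin r := fun i => (eJ i : Fin r) with hγ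
  have hρmono : StrictMono ρ := fun i i' h => by
    simp only [hρ]
    exact_mod_cast eI.strictMono h
  have hγmono : StrictMono γ := fun i i' h => by
    simp only [hγ]
    exact_mod_cast eJ.strictMono h
  have hρI : ∀ i, ρ i ∉ I := fun i => (Finset.mem_sdiff.mp (eI i).2).2
  have hγJ : ∀ i, γ i ∉ J := fun i => (Finset.mem_sdiff.mp (eJ i).2).2
  -- the column permutation: `j` on `I`, the increasing bijection `Iᶜ → Jᶜ` off `I`
  set f : Fin r → Fin r := fun a =>
    if h : a ∈ I then j a else γ (eI.symm ⟨a, Finset.mem_sdiff.mpr ⟨mem_univ _, h⟩⟩) with hf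
  have hfI : ∀ a ∈ I, f a = j a := fun a ha => by simp only [hf, dif_pos ha]
  have hfρ : ∀ i, f (ρ i) = γ i := fun i => by
    simp only [hf, dif_neg (hρI i)]
    congr 1
    apply eI.symm_apply_eq.mpr
    simp only [hρ]
  have hfI_mem : ∀ a ∈ I, f a ∈ J := fun a ha => by
    rw [hfI a ha]
    exact Finset.mem_image_of_mem j ha
  have hfnot : ∀ a ∉ I, f a ∉ J := fun a ha => by
    simp only [hf, dif_neg ha]
    exact hγJ _
  have hfinj : Function.Injective f := by
    intro a a' h
    by_cases ha : a ∈ I <;> by_cases ha' : a' ∈ I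
    · exact hinj ha ha' (by rwa [hfI a ha, hfI a' ha'] at h)
    · exact absurd (h ▸ hfI_mem a ha) (hfnot a' ha')
    · exact absurd (h.symm ▸ hfI_mem a' ha') (hfnot a ha)
    · simp only [hf, dif_neg ha, dif_neg ha', hγ] at h
      have h2 := eJ.injective (Subtype.ext h)
      have h3 := eI.symm.injective h2
      exact congrArg Subtype.val h3
  set π : Equiv.Perm (Fin r) := Equiv.ofBijective f
    ⟨hfinj, Finite.surjective_of_injective hfinj⟩ with hπ
  have hπ_apply : ∀ a, π a = f a := fun a => rfl
  -- permuting the columns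
  set N' : Matrix (Fin r) (Fin r) 𝕜 := N.submatrix id π with hN'
  have hdetN' : ‖N'.det‖ = ‖N.det‖ := by
    rw [hN', Matrix.det_permute', norm_mul, norm_coe_sign_eq_one, one_mul]
  -- block triangularity with the identity in the `I`-block
  have htri : ∀ a, a ∈ I → ∀ b, b ∉ I → N' a b = 0 := fun a ha b hb => by
    simp only [hN', Matrix.submatrix_apply, id, hπ_apply, hrow a ha]
    rw [if_neg]
    intro hb'
    exact hfnot b hb (hb' ▸ Finset.mem_image_of_mem j ha)
  have hblock1 : N'.toSquareBlockProp (fun a => a ∈ I) = 1 := by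
    ext ⟨a, ha⟩ ⟨b, hb⟩
    simp only [Matrix.toSquareBlockProp_def, Matrix.of_apply, hN', Matrix.submatrix_apply, id,
      hπ_apply, hrow a ha, hfI b hb, Matrix.one_apply, Subtype.mk.injEq]
    by_cases hab : a = b
    · subst hab
      simp
    · rw [if_neg, if_neg hab]
      intro h'
      exact hab (hinj ha hb h'.symm)
  have hblock2 : ‖(N'.toSquareBlockProp (fun a => ¬ a ∈ I)).det‖ = ‖(N.submatrix ρ γ).det‖ := by
    -- reindex the complementary block by `Fin (r - |I|)`
    set E : Fin (r - I.card) ≃ {a : Fin r // ¬ a ∈ I} :=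
      eI.toEquiv.trans (Equiv.subtypeEquivRight fun a => by simp [Finset.mem_sdiff]) with hE
    have hEval : ∀ i, ((E i : {a : Fin r // ¬ a ∈ I}) : Fin r) = ρ i := fun i => rfl
    have hsub : (N'.toSquareBlockProp (fun a => ¬ a ∈ I)).submatrix E E = N.submatrix ρ γ := by
      ext i i'
      simp only [Matrix.submatrix_apply, Matrix.toSquareBlockProp_def, Matrix.of_apply, hEval, hN',
        id, hπ_apply, hfρ]
    rw [← hsub, Matrix.det_submatrix_equiv_self]
  -- assemble (`Matrix.det_one` with `(_)`: the `DecidableEq`/`Fintype` structures on the `I`-block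
  -- are the ones produced by `twoBlockTriangular_det'`, to be found by unification, not synthesis)
  rw [← hdetN', Matrix.twoBlockTriangular_det' N' (fun a => a ∈ I) htri, hblock1,
    @Matrix.det_one _ (_) (_) _ _, one_mul, hblock2]
  exact hminor ρ γ hρmono hγmono hρI hγJ

end Matrix
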